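import Summits.MatrixMultiplication.OmegaCensus.STPPSmallPatternOnsetLawSeedsA
import Summits.MatrixMultiplication.OmegaCensus.STPPSmallPatternOnsetLawSeedsB
import Summits.MatrixMultiplication.OmegaCensus.STPPSmallPatternOnsetLawSeedsC
import Summits.MatrixMultiplication.OmegaCensus.STPPSmallPatternTableWitnessesT1
import Summits.MatrixMultiplication.OmegaCensus.STPPSmallPatternTableWitnessesT2A
import Summits.MatrixMultiplication.OmegaCensus.STPPSmallPatternTableWitnessesT2B
import Summits.MatrixMultiplication.OmegaCensus.STPPSmallPatternNone122K4P3x3x3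
import Summits.MatrixMultiplication.OmegaCensus.STPPSmallPatternNone122K4P5x5
import Summits.MatrixMultiplication.OmegaCensus.STPPSmallPatternCyclicRaysT1
import Summits.MatrixMultiplication.OmegaCensus.STPPSmallPatternCyclicRaysT2
import Summits.MatrixMultiplication.OmegaCensus.STPPSmallPatternT1Below24
import Summits.MatrixMultiplication.OmegaCensus.STPPSmallPatternT1OnsetsSmall
import Summits.MatrixMultiplication.OmegaCensus.STPPSmallPatternT2Below24
import Summits.MatrixMultiplication.OmegaCensus.STPP222CubeFrom46

/-!
# ω-census, small STPP patterns: THE SMALL-k ORDER LAWS — the onsets 6, 12, 24 as INTRINSIC EQUIVALENCES over all finite abelian groups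

HONEST FRAMING (pub-omega census; verbatim): lottery ticket; floor = certified bounds/negative ranges.
Census STRUCTURE bookkeeping of the STPP track (seat pub-omega-stpp-3, gen 25; STRUCTURE row B5, columns `T1`, `T2`; prediction P-087 .2
«above the onset, ORDER — not type — decides»), not progress on `ω`: small patterns in small groups bound no exponent.

Five laws (cores named `onsetLawCore…`; ENG2 gen 33's independent `hostCore211K5_of_capped`, p667872, decides the same k = 5 seed set) of the shape of `STPPSmallPatternT2K4OrderLaw.lean` / stpp-2's `STPP222CubeFrom46.lean` (large exponent ⇒ ENG2's cyclic ray
`…_of_addOrderOf`; small exponent ⇒ structure theorem + capped multiset + kernel domination core + prime-power seed witness + `exists_emb_of_dom`):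
every finite abelian group of order `≥ 6` hosts `(2,1,1)²`, of order `≥ 12` hosts `(2,1,1)³` and `(1,2,2)²`, of order `≥ 24` hosts `(2,1,1)⁵` and
`(1,2,2)³`.  With the tree's kernel lower sides (`STPPSmallPatternT1OnsetsSmall`, `…T1Below24`, `…T2Below24`) the onsets become EQUIVALENCES:
`stpp211pow2_iff_card` (`T1 ≥ 2 ⟺ |G| ≥ 6`), `stpp211pow3_iff_card` (`⟺ |G| ≥ 12`), `stpp211pow5_iff_card` (`⟺ |G| ≥ 24`), `stpp122pow2_iff_card`
(`T2 ≥ 2 ⟺ |G| ≥ 12`), `stpp122pow3_iff_card` (`T2 ≥ 3 ⟺ |G| ≥ 24`) — for these k ORDER ALONE decides, at the onset included; for `k = 4`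
(`…T1K4OrderLaw` (ENG2) / `…T2K4OrderLaw`) the onset order is the one type-sensitive exception.

References: H. Cohn, R. Kleinberg, B. Szegedy, C. Umans, FOCS 2005 (arXiv:math/0511460), Def. 5.1.  Records: HOME `pub-omega-stpp-3-g25/work/laws/`
(the five cores checked in Python first, 0 exceptions).
-/

open Literature.Computability.AlgebraicComplexity Finset

namespace Summit.MatrixMultiplication.OmegaCensus

/-- The capping step at a general threshold `N ≤ 46`: if every element `a` of `M` satisfies `46 ≤ a ^ count a C` and `1 ≤ a`, and
`N ≤ M.prod`, then `M ∩ C` still has product `≥ N` (`prod_inter_ge` of `STPP222CubeFrom46.lean`, threshold generalised). -/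
theorem prod_inter_ge_of_le46 {N : ℕ} (hN : N ≤ 46) {M C : Multiset ℕ} (hM : N ≤ M.prod) (hpos : ∀ a ∈ M, 1 ≤ a)
    (hcap : ∀ a ∈ M, 46 ≤ a ^ Multiset.count a C) : N ≤ (M ∩ C).prod := by
  by_cases hle : M ≤ C
  · have : M ∩ C = M := le_antisymm Multiset.inter_le_left (Multiset.le_inter le_rfl hle)
    rw [this]; exact hM
  · rw [Multiset.le_iff_count] at hle
    push Not at hle
    obtain ⟨a, ha⟩ := hle
    have haM : a ∈ M := Multiset.count_pos.1 (by omega)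
    have hcnt : Multiset.count a (M ∩ C) = Multiset.count a C := by
      rw [Multiset.count_inter]; omega
    have hrep : Multiset.replicate (Multiset.count a C) a ≤ M ∩ C :=
      Multiset.le_count_iff_replicate_le.1 hcnt.ge
    obtain ⟨R, hR⟩ := Multiset.le_iff_exists_add.1 hrep
    have hRpos : ∀ x ∈ R, 1 ≤ x := fun x hx =>
      hpos x (Multiset.mem_of_le Multiset.inter_le_left (hR ▸ Multiset.mem_add.2 (Or.inr hx)))
    have h1 : 1 ≤ R.prod := Multiset.one_le_prod_of_one_le hRpos
    rw [hR, Multiset.prod_add, Multiset.prod_replicate]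
    calc N ≤ 46 := hN
      _ ≤ a ^ Multiset.count a C := hcap a haM
      _ = a ^ Multiset.count a C * 1 := (mul_one _).symm
      _ ≤ a ^ Multiset.count a C * R.prod := Nat.mul_le_mul_left _ h1

/-- The structure-theorem step, generic: a finite abelian group of exponent `≤ Emax ≤ 45` and order `≥ N` (`N ≤ 46`) contains an embedded seed
type from any list `L` dominating every capped multiset (exponent `E ≤ Emax`) with product `≥ N`. [folklore] -/
theorem exists_seed_emb_of_capped_core {N Emax : ℕ} (hN : N ≤ 46) (hEmax : Emax ≤ 45) {L : List (List ℕ)}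
    (hcore : ∀ E ∈ List.range' 1 Emax, ∀ M ∈ subMS (capList E), N ≤ M.prod → ∃ s ∈ L, dom s M = true)
    {G : Type*} [AddCommGroup G] [Finite G] (hexp : AddMonoid.exponent G ≤ Emax) (hG : N ≤ Nat.card G) :
    ∃ s ∈ L, ∃ φ : SeedType s →+ G, Function.Injective φ := by
  classical
  obtain ⟨ι, _, p, hp, e, ⟨g⟩⟩ := AddCommGroup.equiv_directSum_zmod_of_finite G
  let f : G ≃+ (Π i, ZMod (p i ^ e i)) :=
    g.trans (DirectSum.linearEquivFunOnFintype ℕ ι (fun i => ZMod (p i ^ e i))).toAddEquiv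
  have hE1 : 1 ≤ AddMonoid.exponent G := Nat.pos_of_ne_zero AddMonoid.exponent_ne_zero_of_finite
  have hdvd : ∀ i, p i ^ e i ∣ AddMonoid.exponent G := fun i => by
    have hinj : Function.Injective (AddMonoidHom.single (fun j => ZMod (p j ^ e j)) i) :=
      Pi.single_injective (M := fun j => ZMod (p j ^ e j)) i
    have h1 : addOrderOf (f.symm (AddMonoidHom.single (fun j => ZMod (p j ^ e j)) i 1)) = p i ^ e i := by
      rw [AddEquiv.addOrderOf_eq, addOrderOf_injective _ hinj, ZMod.addOrderOf_one]
    rw [← h1]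
    exact AddMonoid.addOrder_dvd_exponent _
  have hq0 : ∀ i, p i ^ e i ≠ 0 := fun i => pow_ne_zero _ (hp i).ne_zero
  set M : Multiset ℕ := (Finset.univ.filter fun i => 0 < e i).val.map fun i => p i ^ e i with hM
  have hprodeq : M.prod = ∏ i, p i ^ e i := by
    rw [hM, ← Finset.prod_eq_multiset_prod]
    exact Finset.prod_filter_of_ne fun i _ hi => Nat.pos_of_ne_zero fun h0 => hi (by rw [h0, pow_zero])
  have hcardeq : Nat.card G = ∏ i, p i ^ e i := by
    rw [Nat.card_congr f.toEquiv, Nat.card_pi]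
    simp [Nat.card_zmod]
  have hmem : ∀ a ∈ M, a ∈ ppList ∧ a ∣ AddMonoid.exponent G := by
    intro a ha
    obtain ⟨i, hi, rfl⟩ := Multiset.mem_map.1 ha
    have hi' : 0 < e i := (Finset.mem_filter.1 hi).2
    exact ⟨pow_mem_ppList (hp i) hi' (le_trans (Nat.le_of_dvd (by omega) (hdvd i)) (le_trans hexp hEmax)), hdvd i⟩
  have hEI : AddMonoid.exponent G ∈ List.range' 1 Emax := List.mem_range'_1.2 ⟨hE1, by omega⟩
  have hEI45 : AddMonoid.exponent G ∈ List.range' 1 45 := List.mem_range'_1.2 ⟨hE1, by omega⟩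
  have hprodN : N ≤ M.prod := by rw [hprodeq, ← hcardeq]; exact hG
  set C := capMS (capList (AddMonoid.exponent G)) with hC
  have hcapd := prod_inter_ge_of_le46 hN (C := C) hprodN (fun a ha => one_le_of_mem_ppList (hmem a ha).1)
    (fun a ha => cap_spec _ hEI45 a (hmem a ha).1 (hmem a ha).2)
  have hsub : M ∩ C ∈ subMS (capList (AddMonoid.exponent G)) := mem_subMS_of_le _ _ Multiset.inter_le_right
  obtain ⟨s, hs, hD⟩ := hcore _ hEI (M ∩ C) hsub hcapd
  obtain ⟨φ, hφ, -⟩ := exists_emb_of_dom (fun i => p i ^ e i) hq0 s _ (dom_mono s Multiset.inter_le_left hD)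
  exact ⟨s, hs, f.symm.toAddMonoidHom.comp φ, f.symm.injective.comp hφ⟩

/-! ## `(2,1,1)²`: every finite abelian group of order `≥ 6` hosts -/

/-- The seed types of the `(2,1,1)²` law host (kernel witnesses). [cite: CohnKleinbergSzegedyUmans2005, Def. 5.1] -/
theorem exists_211pow2_of_mem_hostSeeds : ∀ s ∈ ([[4, 2], [2, 2, 2], [3, 3], [5, 5]] : List (List ℕ)),
    ∃ A B C : Fin 2 → Finset (SeedType s), IsSTPP A B C ∧ ∀ i, (A i).card = 2 ∧ (B i).card = 1 ∧ (C i).card = 1 := by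
  intro s hs
  simp only [List.mem_cons, List.mem_nil_iff, or_false] at hs
  rcases hs with rfl | rfl | rfl | rfl
  · exact exists_isSTPP_211pow2_seed_4_2
  · exact exists_isSTPP_211pow2_seed_2_2_2
  · exact exists_isSTPP_211pow2_seed_3_3
  · exact exists_isSTPP_211pow2_seed_5_5

/-- DOMINATION CORE for `(2,1,1)²` (kernel; 29 capped multisets, exponents `E ≤ 5`). -/
theorem onsetLawCore211K2 : ∀ E ∈ List.range' 1 5, ∀ M ∈ subMS (capList E), 6 ≤ M.prod →
    ∃ s ∈ ([[4, 2], [2, 2, 2], [3, 3], [5, 5]] : List (List ℕ)), dom s M = true := by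
  decide +kernel

/-- **LAW: every finite abelian group of order `≥ 6` admits an STPP family of size pattern `(2,1,1)²`.**  No `ω` bound follows.
[cite: CohnKleinbergSzegedyUmans2005, Def. 5.1] -/
theorem exists_isSTPP_211pow2_of_card_ge_6 {G : Type*} [AddCommGroup G] [Finite G] (hG : 6 ≤ Nat.card G) :
    ∃ A B C : Fin 2 → Finset G, IsSTPP A B C ∧ ∀ i, (A i).card = 2 ∧ (B i).card = 1 ∧ (C i).card = 1 := by
  classical
  by_cases hexp : 6 ≤ AddMonoid.exponent G
  · obtain ⟨g, hg⟩ := AddMonoid.exists_addOrderOf_eq_exponent (AddMonoid.ExponentExists.of_finite (G := G))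
    exact exists_isSTPP_211pow2_of_addOrderOf g (by rw [hg]; exact hexp)
  obtain ⟨s, hs, φ, hφ⟩ := exists_seed_emb_of_capped_core (N := 6) (Emax := 5) (by norm_num) (by norm_num) onsetLawCore211K2 (by omega) hG
  exact exists_isSTPP_211_of_injective φ hφ (exists_211pow2_of_mem_hostSeeds s hs)

/-- **`(2,1,1)²` AS AN INTRINSIC EQUIVALENCE (kernel, all finite abelian groups): hosted iff the order is `≥ 6`.**
[cite: CohnKleinbergSzegedyUmans2005, Def. 5.1] -/
theorem stpp211pow2_iff_card {G : Type*} [AddCommGroup G] [Finite G] :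
    (∃ A B C : Fin 2 → Finset G, IsSTPP A B C ∧ ∀ i, (A i).card = 2 ∧ (B i).card = 1 ∧ (C i).card = 1) ↔ 6 ≤ Nat.card G :=
  ⟨fun h => by
    by_contra hlt
    exact not_exists_isSTPP_211pow2_of_card_le (by omega) h,
    fun h => exists_isSTPP_211pow2_of_card_ge_6 h⟩

/-! ## `(2,1,1)³`: every finite abelian group of order `≥ 12` hosts -/

/-- The seed types of the `(2,1,1)³` law host (kernel witnesses). [cite: CohnKleinbergSzegedyUmans2005, Def. 5.1] -/
theorem exists_211pow3_of_mem_hostSeeds : ∀ s ∈ ([[3, 2, 2], [4, 4], [8, 2], [4, 2, 2], [2, 2, 2, 2], [3, 3, 2], [5, 2, 2], [5, 5], [9, 3], [3, 3, 3], [7, 7], [11, 11]] : List (List ℕ)),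
    ∃ A B C : Fin 3 → Finset (SeedType s), IsSTPP A B C ∧ ∀ i, (A i).card = 2 ∧ (B i).card = 1 ∧ (C i).card = 1 := by
  intro s hs
  simp only [List.mem_cons, List.mem_nil_iff, or_false] at hs
  rcases hs with rfl | rfl | rfl | rfl | rfl | rfl | rfl | rfl | rfl | rfl | rfl | rfl
  · exact exists_isSTPP_211pow3_seed_3_2_2
  · exact exists_isSTPP_211pow3_seed_4_4
  · exact exists_isSTPP_211pow3_seed_8_2
  · exact exists_isSTPP_211pow3_seed_4_2_2
  · exact exists_isSTPP_211pow3_seed_2_2_2_2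
  · exact exists_isSTPP_211pow3_seed_3_3_2
  · exact exists_isSTPP_211pow3_seed_5_2_2
  · exact exists_isSTPP_211pow3_seed_5_5
  · exact exists_isSTPP_211pow3_seed_9_3
  · exact exists_isSTPP_211pow3_seed_3_3_3
  · exact exists_isSTPP_211pow3_seed_7_7
  · exact exists_isSTPP_211pow3_seed_11_11

/-- DOMINATION CORE for `(2,1,1)³` (kernel; 132 capped multisets, exponents `E ≤ 11`). -/
theorem onsetLawCore211K3 : ∀ E ∈ List.range' 1 11, ∀ M ∈ subMS (capList E), 12 ≤ M.prod →
    ∃ s ∈ ([[3, 2, 2], [4, 4], [8, 2], [4, 2, 2], [2, 2, 2, 2], [3, 3, 2], [5, 2, 2], [5, 5], [9, 3], [3, 3, 3], [7, 7], [11, 11]] : List (List ℕ)), dom s M = true := by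
  decide +kernel

/-- **LAW: every finite abelian group of order `≥ 12` admits an STPP family of size pattern `(2,1,1)³`.**  No `ω` bound follows.
[cite: CohnKleinbergSzegedyUmans2005, Def. 5.1] -/
theorem exists_isSTPP_211pow3_of_card_ge_12 {G : Type*} [AddCommGroup G] [Finite G] (hG : 12 ≤ Nat.card G) :
    ∃ A B C : Fin 3 → Finset G, IsSTPP A B C ∧ ∀ i, (A i).card = 2 ∧ (B i).card = 1 ∧ (C i).card = 1 := by
  classical
  by_cases hexp : 12 ≤ AddMonoid.exponent G
  · obtain ⟨g, hg⟩ := AddMonoid.exists_addOrderOf_eq_exponent (AddMonoid.ExponentExists.of_finite (G := G))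
    exact exists_isSTPP_211pow3_of_addOrderOf g (by rw [hg]; exact hexp)
  obtain ⟨s, hs, φ, hφ⟩ := exists_seed_emb_of_capped_core (N := 12) (Emax := 11) (by norm_num) (by norm_num) onsetLawCore211K3 (by omega) hG
  exact exists_isSTPP_211_of_injective φ hφ (exists_211pow3_of_mem_hostSeeds s hs)

/-- **`(2,1,1)³` AS AN INTRINSIC EQUIVALENCE (kernel, all finite abelian groups): hosted iff the order is `≥ 12`.**
[cite: CohnKleinbergSzegedyUmans2005, Def. 5.1] -/
theorem stpp211pow3_iff_card {G : Type*} [AddCommGroup G] [Finite G] :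
    (∃ A B C : Fin 3 → Finset G, IsSTPP A B C ∧ ∀ i, (A i).card = 2 ∧ (B i).card = 1 ∧ (C i).card = 1) ↔ 12 ≤ Nat.card G :=
  ⟨fun h => by
    by_contra hlt
    exact not_exists_isSTPP_211pow3_of_card_le (by omega) h,
    fun h => exists_isSTPP_211pow3_of_card_ge_12 h⟩

/-! ## `(2,1,1)⁵`: every finite abelian group of order `≥ 24` hosts -/

/-- The seed types of the `(2,1,1)⁵` law host (kernel witnesses). [cite: CohnKleinbergSzegedyUmans2005, Def. 5.1] -/
theorem exists_211pow5_of_mem_hostSeeds : ∀ s ∈ ([[4, 3, 2], [3, 2, 2, 2], [5, 5], [9, 3], [3, 3, 3], [7, 2, 2], [8, 4], [16, 2], [4, 4, 2], [8, 2, 2], [4, 2, 2, 2], [2, 2, 2, 2, 2], [4, 3, 3], [9, 2, 2], [3, 3, 2, 2], [5, 4, 2], [5, 2, 2, 2], [11, 2, 2], [5, 3, 3], [7, 7], [7, 3, 3], [11, 11], [13, 13], [17, 17], [19, 19], [23, 23]] : List (List ℕ)),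
    ∃ A B C : Fin 5 → Finset (SeedType s), IsSTPP A B C ∧ ∀ i, (A i).card = 2 ∧ (B i).card = 1 ∧ (C i).card = 1 := by
  intro s hs
  simp only [List.mem_cons, List.mem_nil_iff, or_false] at hs
  rcases hs with rfl | rfl | rfl | rfl | rfl | rfl | rfl | rfl | rfl | rfl | rfl | rfl | rfl | rfl | rfl | rfl | rfl | rfl | rfl | rfl | rfl | rfl | rfl | rfl | rfl | rfl
  · exact exists_isSTPP_211pow5_seed_4_3_2
  · exact exists_isSTPP_211pow5_seed_3_2_2_2
  · exact exists_isSTPP_211pow5_zmod5_zmod5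
  · exact exists_isSTPP_211pow5_seed_9_3
  · exact exists_isSTPP_211pow5_zmod3_zmod3_zmod3
  · exact exists_isSTPP_211pow5_seed_7_2_2
  · exact exists_isSTPP_211pow5_seed_8_4
  · exact exists_isSTPP_211pow5_seed_16_2
  · exact exists_isSTPP_211pow5_seed_4_4_2
  · exact exists_isSTPP_211pow5_seed_8_2_2
  · exact exists_isSTPP_211pow5_seed_4_2_2_2
  · exact exists_isSTPP_211pow5_seed_2_2_2_2_2
  · exact exists_isSTPP_211pow5_seed_4_3_3
  · exact exists_isSTPP_211pow5_seed_9_2_2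
  · exact exists_isSTPP_211pow5_seed_3_3_2_2
  · exact exists_isSTPP_211pow5_seed_5_4_2
  · exact exists_isSTPP_211pow5_seed_5_2_2_2
  · exact exists_isSTPP_211pow5_seed_11_2_2
  · exact exists_isSTPP_211pow5_seed_5_3_3
  · exact exists_isSTPP_211pow5_seed_7_7
  · exact exists_isSTPP_211pow5_seed_7_3_3
  · exact exists_isSTPP_211pow5_seed_11_11
  · exact exists_isSTPP_211pow5_seed_13_13
  · exact exists_isSTPP_211pow5_seed_17_17
  · exact exists_isSTPP_211pow5_seed_19_19
  · exact exists_isSTPP_211pow5_seed_23_23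

/-- DOMINATION CORE for `(2,1,1)⁵` (kernel; 540 capped multisets, exponents `E ≤ 23`). -/
theorem onsetLawCore211K5 : ∀ E ∈ List.range' 1 23, ∀ M ∈ subMS (capList E), 24 ≤ M.prod →
    ∃ s ∈ ([[4, 3, 2], [3, 2, 2, 2], [5, 5], [9, 3], [3, 3, 3], [7, 2, 2], [8, 4], [16, 2], [4, 4, 2], [8, 2, 2], [4, 2, 2, 2], [2, 2, 2, 2, 2], [4, 3, 3], [9, 2, 2], [3, 3, 2, 2], [5, 4, 2], [5, 2, 2, 2], [11, 2, 2], [5, 3, 3], [7, 7], [7, 3, 3], [11, 11], [13, 13], [17, 17], [19, 19], [23, 23]] : List (List ℕ)), dom s M = true := by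
  decide +kernel

/-- **LAW: every finite abelian group of order `≥ 24` admits an STPP family of size pattern `(2,1,1)⁵`.**  No `ω` bound follows.
[cite: CohnKleinbergSzegedyUmans2005, Def. 5.1] -/
theorem exists_isSTPP_211pow5_of_card_ge_24 {G : Type*} [AddCommGroup G] [Finite G] (hG : 24 ≤ Nat.card G) :
    ∃ A B C : Fin 5 → Finset G, IsSTPP A B C ∧ ∀ i, (A i).card = 2 ∧ (B i).card = 1 ∧ (C i).card = 1 := by
  classical
  by_cases hexp : 24 ≤ AddMonoid.exponent G
  · obtain ⟨g, hg⟩ := AddMonoid.exists_addOrderOf_eq_exponent (AddMonoid.ExponentExists.of_finite (G := G))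
    exact exists_isSTPP_211pow5_of_addOrderOf g (by rw [hg]; exact hexp)
  obtain ⟨s, hs, φ, hφ⟩ := exists_seed_emb_of_capped_core (N := 24) (Emax := 23) (by norm_num) (by norm_num) onsetLawCore211K5 (by omega) hG
  exact exists_isSTPP_211_of_injective φ hφ (exists_211pow5_of_mem_hostSeeds s hs)

/-- **`(2,1,1)⁵` AS AN INTRINSIC EQUIVALENCE (kernel, all finite abelian groups): hosted iff the order is `≥ 24`.**
[cite: CohnKleinbergSzegedyUmans2005, Def. 5.1] -/
theorem stpp211pow5_iff_card {G : Type*} [AddCommGroup G] [Finite G] :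
    (∃ A B C : Fin 5 → Finset G, IsSTPP A B C ∧ ∀ i, (A i).card = 2 ∧ (B i).card = 1 ∧ (C i).card = 1) ↔ 24 ≤ Nat.card G :=
  ⟨fun h => by
    by_contra hlt
    exact not_exists_isSTPP_211pow5_of_card_le (by omega) h,
    fun h => exists_isSTPP_211pow5_of_card_ge_24 h⟩

/-! ## `(1,2,2)²`: every finite abelian group of order `≥ 12` hosts -/

/-- The seed types of the `(1,2,2)²` law host (kernel witnesses). [cite: CohnKleinbergSzegedyUmans2005, Def. 5.1] -/
theorem exists_122pow2_of_mem_hostSeeds : ∀ s ∈ ([[3, 2, 2], [4, 4], [8, 2], [4, 2, 2], [2, 2, 2, 2], [3, 3, 2], [5, 2, 2], [5, 5], [9, 3], [3, 3, 3], [7, 7], [11, 11]] : List (List ℕ)),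
    ∃ A B C : Fin 2 → Finset (SeedType s), IsSTPP A B C ∧ ∀ i, (A i).card = 1 ∧ (B i).card = 2 ∧ (C i).card = 2 := by
  intro s hs
  simp only [List.mem_cons, List.mem_nil_iff, or_false] at hs
  rcases hs with rfl | rfl | rfl | rfl | rfl | rfl | rfl | rfl | rfl | rfl | rfl | rfl
  · exact exists_isSTPP_122pow2_seed_3_2_2
  · exact exists_isSTPP_122pow2_zmod4_zmod4
  · exact exists_isSTPP_122pow2_seed_8_2
  · exact exists_isSTPP_122pow2_seed_4_2_2
  · exact exists_isSTPP_122pow2_zmod2_zmod2_zmod2_zmod2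
  · exact exists_isSTPP_122pow2_seed_3_3_2
  · exact exists_isSTPP_122pow2_seed_5_2_2
  · exact exists_isSTPP_122pow2_seed_5_5
  · exact exists_isSTPP_122pow2_seed_9_3
  · exact exists_isSTPP_122pow2_seed_3_3_3
  · exact exists_isSTPP_122pow2_seed_7_7
  · exact exists_isSTPP_122pow2_seed_11_11

/-- DOMINATION CORE for `(1,2,2)²` (kernel; 132 capped multisets, exponents `E ≤ 11`). -/
theorem onsetLawCore122K2 : ∀ E ∈ List.range' 1 11, ∀ M ∈ subMS (capList E), 12 ≤ M.prod →
    ∃ s ∈ ([[3, 2, 2], [4, 4], [8, 2], [4, 2, 2], [2, 2, 2, 2], [3, 3, 2], [5, 2, 2], [5, 5], [9, 3], [3, 3, 3], [7, 7], [11, 11]] : List (List ℕ)), dom s M = true := by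
  decide +kernel

/-- **LAW: every finite abelian group of order `≥ 12` admits an STPP family of size pattern `(1,2,2)²`.**  No `ω` bound follows.
[cite: CohnKleinbergSzegedyUmans2005, Def. 5.1] -/
theorem exists_isSTPP_122pow2_of_card_ge_12 {G : Type*} [AddCommGroup G] [Finite G] (hG : 12 ≤ Nat.card G) :
    ∃ A B C : Fin 2 → Finset G, IsSTPP A B C ∧ ∀ i, (A i).card = 1 ∧ (B i).card = 2 ∧ (C i).card = 2 := by
  classical
  by_cases hexp : 12 ≤ AddMonoid.exponent G
  · obtain ⟨g, hg⟩ := AddMonoid.exists_addOrderOf_eq_exponent (AddMonoid.ExponentExists.of_finite (G := G))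
    exact exists_isSTPP_122pow2_of_addOrderOf g (by rw [hg]; exact hexp)
  obtain ⟨s, hs, φ, hφ⟩ := exists_seed_emb_of_capped_core (N := 12) (Emax := 11) (by norm_num) (by norm_num) onsetLawCore122K2 (by omega) hG
  exact exists_isSTPP_122_of_injective φ hφ (exists_122pow2_of_mem_hostSeeds s hs)

/-- **`(1,2,2)²` AS AN INTRINSIC EQUIVALENCE (kernel, all finite abelian groups): hosted iff the order is `≥ 12`.**
[cite: CohnKleinbergSzegedyUmans2005, Def. 5.1] -/
theorem stpp122pow2_iff_card {G : Type*} [AddCommGroup G] [Finite G] :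
    (∃ A B C : Fin 2 → Finset G, IsSTPP A B C ∧ ∀ i, (A i).card = 1 ∧ (B i).card = 2 ∧ (C i).card = 2) ↔ 12 ≤ Nat.card G :=
  ⟨fun h => by
    by_contra hlt
    exact not_exists_isSTPP_122pow2_of_card_le (by omega) h,
    fun h => exists_isSTPP_122pow2_of_card_ge_12 h⟩

/-! ## `(1,2,2)³`: every finite abelian group of order `≥ 24` hosts -/

/-- The seed types of the `(1,2,2)³` law host (kernel witnesses). [cite: CohnKleinbergSzegedyUmans2005, Def. 5.1] -/
theorem exists_122pow3_of_mem_hostSeeds : ∀ s ∈ ([[4, 3, 2], [3, 2, 2, 2], [5, 5], [9, 3], [3, 3, 3], [7, 2, 2], [8, 4], [16, 2], [4, 4, 2], [8, 2, 2], [4, 2, 2, 2], [2, 2, 2, 2, 2], [4, 3, 3], [9, 2, 2], [3, 3, 2, 2], [5, 4, 2], [5, 2, 2, 2], [11, 2, 2], [5, 3, 3], [7, 7], [7, 3, 3], [11, 11], [13, 13], [17, 17], [19, 19], [23, 23]] : List (List ℕ)),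
    ∃ A B C : Fin 3 → Finset (SeedType s), IsSTPP A B C ∧ ∀ i, (A i).card = 1 ∧ (B i).card = 2 ∧ (C i).card = 2 := by
  intro s hs
  simp only [List.mem_cons, List.mem_nil_iff, or_false] at hs
  rcases hs with rfl | rfl | rfl | rfl | rfl | rfl | rfl | rfl | rfl | rfl | rfl | rfl | rfl | rfl | rfl | rfl | rfl | rfl | rfl | rfl | rfl | rfl | rfl | rfl | rfl | rfl
  · exact exists_isSTPP_122pow3_seed_4_3_2
  · exact exists_isSTPP_122pow3_seed_3_2_2_2
  · exact exists_isSTPP_122pow3_z5_z5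
  · exact exists_isSTPP_122pow3_seed_9_3
  · exact exists_isSTPP_122pow3_z3_z3_z3
  · exact exists_isSTPP_122pow3_seed_7_2_2
  · exact exists_isSTPP_122pow3_seed_8_4
  · exact exists_isSTPP_122pow3_seed_16_2
  · exact exists_isSTPP_122pow3_seed_4_4_2
  · exact exists_isSTPP_122pow3_seed_8_2_2
  · exact exists_isSTPP_122pow3_seed_4_2_2_2
  · exact exists_isSTPP_122pow3_zmod2_zmod2_zmod2_zmod2_zmod2
  · exact exists_isSTPP_122pow3_seed_4_3_3
  · exact exists_isSTPP_122pow3_seed_9_2_2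
  · exact exists_isSTPP_122pow3_seed_3_3_2_2
  · exact exists_isSTPP_122pow3_seed_5_4_2
  · exact exists_isSTPP_122pow3_seed_5_2_2_2
  · exact exists_isSTPP_122pow3_seed_11_2_2
  · exact exists_isSTPP_122pow3_seed_5_3_3
  · exact exists_isSTPP_122pow3_seed_7_7
  · exact exists_isSTPP_122pow3_seed_7_3_3
  · exact exists_isSTPP_122pow3_seed_11_11
  · exact exists_isSTPP_122pow3_seed_13_13
  · exact exists_isSTPP_122pow3_seed_17_17
  · exact exists_isSTPP_122pow3_seed_19_19
  · exact exists_isSTPP_122pow3_seed_23_23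

/-- DOMINATION CORE for `(1,2,2)³` (kernel; 540 capped multisets, exponents `E ≤ 23`). -/
theorem onsetLawCore122K3 : ∀ E ∈ List.range' 1 23, ∀ M ∈ subMS (capList E), 24 ≤ M.prod →
    ∃ s ∈ ([[4, 3, 2], [3, 2, 2, 2], [5, 5], [9, 3], [3, 3, 3], [7, 2, 2], [8, 4], [16, 2], [4, 4, 2], [8, 2, 2], [4, 2, 2, 2], [2, 2, 2, 2, 2], [4, 3, 3], [9, 2, 2], [3, 3, 2, 2], [5, 4, 2], [5, 2, 2, 2], [11, 2, 2], [5, 3, 3], [7, 7], [7, 3, 3], [11, 11], [13, 13], [17, 17], [19, 19], [23, 23]] : List (List ℕ)), dom s M = true := by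
  decide +kernel

/-- **LAW: every finite abelian group of order `≥ 24` admits an STPP family of size pattern `(1,2,2)³`.**  No `ω` bound follows.
[cite: CohnKleinbergSzegedyUmans2005, Def. 5.1] -/
theorem exists_isSTPP_122pow3_of_card_ge_24 {G : Type*} [AddCommGroup G] [Finite G] (hG : 24 ≤ Nat.card G) :
    ∃ A B C : Fin 3 → Finset G, IsSTPP A B C ∧ ∀ i, (A i).card = 1 ∧ (B i).card = 2 ∧ (C i).card = 2 := by
  classical
  by_cases hexp : 24 ≤ AddMonoid.exponent G
  · obtain ⟨g, hg⟩ := AddMonoid.exists_addOrderOf_eq_exponent (AddMonoid.ExponentExists.of_finite (G := G))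
    exact exists_isSTPP_122pow3_of_addOrderOf g (by rw [hg]; exact hexp)
  obtain ⟨s, hs, φ, hφ⟩ := exists_seed_emb_of_capped_core (N := 24) (Emax := 23) (by norm_num) (by norm_num) onsetLawCore122K3 (by omega) hG
  exact exists_isSTPP_122_of_injective φ hφ (exists_122pow3_of_mem_hostSeeds s hs)

/-- **`(1,2,2)³` AS AN INTRINSIC EQUIVALENCE (kernel, all finite abelian groups): hosted iff the order is `≥ 24`.**
[cite: CohnKleinbergSzegedyUmans2005, Def. 5.1] -/
theorem stpp122pow3_iff_card {G : Type*} [AddCommGroup G] [Finite G] :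
    (∃ A B C : Fin 3 → Finset G, IsSTPP A B C ∧ ∀ i, (A i).card = 1 ∧ (B i).card = 2 ∧ (C i).card = 2) ↔ 24 ≤ Nat.card G :=
  ⟨fun h => by
    by_contra hlt
    exact not_exists_isSTPP_122pow3_of_card_le (by omega) h,
    fun h => exists_isSTPP_122pow3_of_card_ge_24 h⟩

end Summit.MatrixMultiplication.OmegaCensus
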